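import Summits.CriticalPhenomena.PercolationContinuityZ3.Theorems.PercNearOneGluingNoHeavyLowerTailSahiGridPatternCover
import Summits.CriticalPhenomena.PercolationContinuityZ3.Theorems.PercNearOneGluingNoHeavyLowerTailSahiGridPatternSlices1
import Summits.CriticalPhenomena.PercolationContinuityZ3.Theorems.PercNearOneGluingNoHeavyLowerTailSahiGridPatternSlices2
import Summits.CriticalPhenomena.PercolationContinuityZ3.Theorems.PercNearOneGluingNoHeavyLowerTailSahiGridPatternSlices3
import Summits.CriticalPhenomena.PercolationContinuityZ3.Theorems.PercNearOneGluingNoHeavyLowerTailSahiGridPatternSlices4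
import Summits.CriticalPhenomena.PercolationContinuityZ3.Theorems.PercNearOneGluingNoHeavyLowerTailSahiGridPatternSlices5
import Summits.CriticalPhenomena.PercolationContinuityZ3.Theorems.PercNearOneGluingNoHeavyLowerTailSahiGridPatternSlices6
import Summits.CriticalPhenomena.PercolationContinuityZ3.Theorems.PercNearOneGluingNoHeavyLowerTailSahiGridPatternSlices7
import Summits.CriticalPhenomena.PercolationContinuityZ3.Theorems.PercNearOneGluingNoHeavyLowerTailSahiGridPatternSlices8
import Summits.CriticalPhenomena.PercolationContinuityZ3.Theorems.PercNearOneGluingNoHeavyLowerTailSahiGridPatternSlices9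
import Summits.CriticalPhenomena.PercolationContinuityZ3.Theorems.PercNearOneGluingNoHeavyLowerTailSahiGridPatternSlices10
import Summits.CriticalPhenomena.PercolationContinuityZ3.Theorems.PercNearOneGluingNoHeavyLowerTailSahiGridPatternSlices11
import Summits.CriticalPhenomena.PercolationContinuityZ3.Theorems.PercNearOneGluingNoHeavyLowerTailSahiGridPatternSlices12
import Summits.CriticalPhenomena.PercolationContinuityZ3.Theorems.PercNearOneGluingNoHeavyLowerTailSahiGridPatternSlices13
import Summits.CriticalPhenomena.PercolationContinuityZ3.Theorems.PercNearOneGluingNoHeavyLowerTailSahiGridPatternSlices14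
import Summits.CriticalPhenomena.PercolationContinuityZ3.Theorems.PercNearOneGluingNoHeavyLowerTailSahiGridPatternSlices15
import Summits.CriticalPhenomena.PercolationContinuityZ3.Theorems.PercNearOneGluingNoHeavyLowerTailSahiGridPatternSlices16

/-!
# `NoHeavyLowerTail` (crux stmt-CriticalPhenomena-4575), Sahi programme P1: **`PatternPos 3` and the cell `(3,3)` WITH STANDARD
# AXIOMS** — Sahi's `C₃` on every three-dimensional grid, kernel-only

Support file (Sahi cell, seat `prim-sahi-p1`, generation 7; `--supports stmt-CriticalPhenomena-4575`).  No definitions, no `sorry`, no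
`native_decide`: this file upgrades the generation-6 theorem `SahiGrid3.latticeE3_gridProd_three_nonneg` (which rests on eleven declared
`native_decide` facts) to a KERNEL-CHECKED theorem with axioms `propext`, `Classical.choice`, `Quot.sound` only.

THE PROOF (human-readable structure).  (1) Localisation (`…SahiGridPattern`): `Z³E₃ ≥ 0` on every grid `[K+1]³` with product
weights follows from the `[3]³` pattern inequality `PatternPos 3`: `sStarD A B C ≥ 0` for up-sets `A, B, C` of the small cube.
(2) Trilinearity and the closed form of the pattern tensor `t` (`…SahiGridPatternTensor`): `sStarD A B C = Σ_{p∈A,q∈B,r∈C} t(p,q,r)`.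
(3) THE CERTIFICATES: although `t` itself is NOT a nonnegative combination of products `γ₁⊗γ₂⊗γ₃` of point evaluations and upward
cover differences (exact Farkas witness, item 4575 evidence), for EVERY up-set `A` the bilinear slice `β_A = Σ_{p∈A} t(p,·,·)` IS:
`L_A·β_A = Σ_k c_k γ_k⊗γ'_k` with `c_k ∈ ℕ` — `226` such identities (one per axis orbit of up-sets, `84 775` terms in all, found by
linear programming and exact rational reconstruction, kit j098799) are verified by the kernel in `…SahiGridPatternSlices1–16`; since
`γ(B) ≥ 0` for every up-set `B`, `Σ_{q∈B,r∈C} β_A(q,r) ≥ 0`.  (4) The cover (`…SahiGridPatternCover`): every up-set is an axis-permuted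
representative, and `t` is invariant under axis permutations.
CONSEQUENCES (all kernel-only now; stated in EXPLICIT form — the named forms `PatternPos 3`, `SahiPositive μ 3`, `LiebSahiContinuum 3 3`
already carry computational proofs in the tree and are obtained from these by one-line terms, see the docstrings): `sStarD_three_nonneg`
(the `[3]³` pattern inequality), `sahiE_three_nonneg_fkg_grid3` (`E₃ ≥ 0` for every FKG weight on every 3-D grid and all nonnegative
monotone triples), `Ssym_three_nonneg` (coefficientwise form on every 3-D grid), `msahiE_three_volume_cube_nonneg` (Lieb–Sahi's
Conjecture 1.1 on `[0,1]³` at order 3, increasing form, Lebesgue measure). [this work]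
-/

namespace Summit.CriticalPhenomena.PercolationContinuityZ3.Theorems.SahiGridPattern

open Finset SahiGrid3 Literature.Probability.LatticeModels Literature.Combinatorics.Sahi2008

/-- **All `226` representatives are slice-positive** (collecting `slice_0 … slice_225`). [this work] -/
theorem slices_all : ∀ w ∈ repVecs, ∀ B C : Finset P3, IsUpperSet (B : Set P3) → IsUpperSet (C : Set P3) →
    0 ≤ ∑ p ∈ U w, ∑ q ∈ B, ∑ r ∈ C, tcP p q r := by
  unfold repVecs
  refine List.forall_mem_cons.2 ⟨slice_0, ?_⟩
  refine List.forall_mem_cons.2 ⟨slice_1, ?_⟩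
  refine List.forall_mem_cons.2 ⟨slice_2, ?_⟩
  refine List.forall_mem_cons.2 ⟨slice_3, ?_⟩
  refine List.forall_mem_cons.2 ⟨slice_4, ?_⟩
  refine List.forall_mem_cons.2 ⟨slice_5, ?_⟩
  refine List.forall_mem_cons.2 ⟨slice_6, ?_⟩
  refine List.forall_mem_cons.2 ⟨slice_7, ?_⟩
  refine List.forall_mem_cons.2 ⟨slice_8, ?_⟩
  refine List.forall_mem_cons.2 ⟨slice_9, ?_⟩
  refine List.forall_mem_cons.2 ⟨slice_10, ?_⟩
  refine List.forall_mem_cons.2 ⟨slice_11, ?_⟩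
  refine List.forall_mem_cons.2 ⟨slice_12, ?_⟩
  refine List.forall_mem_cons.2 ⟨slice_13, ?_⟩
  refine List.forall_mem_cons.2 ⟨slice_14, ?_⟩
  refine List.forall_mem_cons.2 ⟨slice_15, ?_⟩
  refine List.forall_mem_cons.2 ⟨slice_16, ?_⟩
  refine List.forall_mem_cons.2 ⟨slice_17, ?_⟩
  refine List.forall_mem_cons.2 ⟨slice_18, ?_⟩
  refine List.forall_mem_cons.2 ⟨slice_19, ?_⟩
  refine List.forall_mem_cons.2 ⟨slice_20, ?_⟩
  refine List.forall_mem_cons.2 ⟨slice_21, ?_⟩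
  refine List.forall_mem_cons.2 ⟨slice_22, ?_⟩
  refine List.forall_mem_cons.2 ⟨slice_23, ?_⟩
  refine List.forall_mem_cons.2 ⟨slice_24, ?_⟩
  refine List.forall_mem_cons.2 ⟨slice_25, ?_⟩
  refine List.forall_mem_cons.2 ⟨slice_26, ?_⟩
  refine List.forall_mem_cons.2 ⟨slice_27, ?_⟩
  refine List.forall_mem_cons.2 ⟨slice_28, ?_⟩
  refine List.forall_mem_cons.2 ⟨slice_29, ?_⟩
  refine List.forall_mem_cons.2 ⟨slice_30, ?_⟩
  refine List.forall_mem_cons.2 ⟨slice_31, ?_⟩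
  refine List.forall_mem_cons.2 ⟨slice_32, ?_⟩
  refine List.forall_mem_cons.2 ⟨slice_33, ?_⟩
  refine List.forall_mem_cons.2 ⟨slice_34, ?_⟩
  refine List.forall_mem_cons.2 ⟨slice_35, ?_⟩
  refine List.forall_mem_cons.2 ⟨slice_36, ?_⟩
  refine List.forall_mem_cons.2 ⟨slice_37, ?_⟩
  refine List.forall_mem_cons.2 ⟨slice_38, ?_⟩
  refine List.forall_mem_cons.2 ⟨slice_39, ?_⟩
  refine List.forall_mem_cons.2 ⟨slice_40, ?_⟩
  refine List.forall_mem_cons.2 ⟨slice_41, ?_⟩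
  refine List.forall_mem_cons.2 ⟨slice_42, ?_⟩
  refine List.forall_mem_cons.2 ⟨slice_43, ?_⟩
  refine List.forall_mem_cons.2 ⟨slice_44, ?_⟩
  refine List.forall_mem_cons.2 ⟨slice_45, ?_⟩
  refine List.forall_mem_cons.2 ⟨slice_46, ?_⟩
  refine List.forall_mem_cons.2 ⟨slice_47, ?_⟩
  refine List.forall_mem_cons.2 ⟨slice_48, ?_⟩
  refine List.forall_mem_cons.2 ⟨slice_49, ?_⟩
  refine List.forall_mem_cons.2 ⟨slice_50, ?_⟩
  refine List.forall_mem_cons.2 ⟨slice_51, ?_⟩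
  refine List.forall_mem_cons.2 ⟨slice_52, ?_⟩
  refine List.forall_mem_cons.2 ⟨slice_53, ?_⟩
  refine List.forall_mem_cons.2 ⟨slice_54, ?_⟩
  refine List.forall_mem_cons.2 ⟨slice_55, ?_⟩
  refine List.forall_mem_cons.2 ⟨slice_56, ?_⟩
  refine List.forall_mem_cons.2 ⟨slice_57, ?_⟩
  refine List.forall_mem_cons.2 ⟨slice_58, ?_⟩
  refine List.forall_mem_cons.2 ⟨slice_59, ?_⟩
  refine List.forall_mem_cons.2 ⟨slice_60, ?_⟩
  refine List.forall_mem_cons.2 ⟨slice_61, ?_⟩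
  refine List.forall_mem_cons.2 ⟨slice_62, ?_⟩
  refine List.forall_mem_cons.2 ⟨slice_63, ?_⟩
  refine List.forall_mem_cons.2 ⟨slice_64, ?_⟩
  refine List.forall_mem_cons.2 ⟨slice_65, ?_⟩
  refine List.forall_mem_cons.2 ⟨slice_66, ?_⟩
  refine List.forall_mem_cons.2 ⟨slice_67, ?_⟩
  refine List.forall_mem_cons.2 ⟨slice_68, ?_⟩
  refine List.forall_mem_cons.2 ⟨slice_69, ?_⟩
  refine List.forall_mem_cons.2 ⟨slice_70, ?_⟩
  refine List.forall_mem_cons.2 ⟨slice_71, ?_⟩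
  refine List.forall_mem_cons.2 ⟨slice_72, ?_⟩
  refine List.forall_mem_cons.2 ⟨slice_73, ?_⟩
  refine List.forall_mem_cons.2 ⟨slice_74, ?_⟩
  refine List.forall_mem_cons.2 ⟨slice_75, ?_⟩
  refine List.forall_mem_cons.2 ⟨slice_76, ?_⟩
  refine List.forall_mem_cons.2 ⟨slice_77, ?_⟩
  refine List.forall_mem_cons.2 ⟨slice_78, ?_⟩
  refine List.forall_mem_cons.2 ⟨slice_79, ?_⟩
  refine List.forall_mem_cons.2 ⟨slice_80, ?_⟩
  refine List.forall_mem_cons.2 ⟨slice_81, ?_⟩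
  refine List.forall_mem_cons.2 ⟨slice_82, ?_⟩
  refine List.forall_mem_cons.2 ⟨slice_83, ?_⟩
  refine List.forall_mem_cons.2 ⟨slice_84, ?_⟩
  refine List.forall_mem_cons.2 ⟨slice_85, ?_⟩
  refine List.forall_mem_cons.2 ⟨slice_86, ?_⟩
  refine List.forall_mem_cons.2 ⟨slice_87, ?_⟩
  refine List.forall_mem_cons.2 ⟨slice_88, ?_⟩
  refine List.forall_mem_cons.2 ⟨slice_89, ?_⟩
  refine List.forall_mem_cons.2 ⟨slice_90, ?_⟩
  refine List.forall_mem_cons.2 ⟨slice_91, ?_⟩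
  refine List.forall_mem_cons.2 ⟨slice_92, ?_⟩
  refine List.forall_mem_cons.2 ⟨slice_93, ?_⟩
  refine List.forall_mem_cons.2 ⟨slice_94, ?_⟩
  refine List.forall_mem_cons.2 ⟨slice_95, ?_⟩
  refine List.forall_mem_cons.2 ⟨slice_96, ?_⟩
  refine List.forall_mem_cons.2 ⟨slice_97, ?_⟩
  refine List.forall_mem_cons.2 ⟨slice_98, ?_⟩
  refine List.forall_mem_cons.2 ⟨slice_99, ?_⟩
  refine List.forall_mem_cons.2 ⟨slice_100, ?_⟩
  refine List.forall_mem_cons.2 ⟨slice_101, ?_⟩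
  refine List.forall_mem_cons.2 ⟨slice_102, ?_⟩
  refine List.forall_mem_cons.2 ⟨slice_103, ?_⟩
  refine List.forall_mem_cons.2 ⟨slice_104, ?_⟩
  refine List.forall_mem_cons.2 ⟨slice_105, ?_⟩
  refine List.forall_mem_cons.2 ⟨slice_106, ?_⟩
  refine List.forall_mem_cons.2 ⟨slice_107, ?_⟩
  refine List.forall_mem_cons.2 ⟨slice_108, ?_⟩
  refine List.forall_mem_cons.2 ⟨slice_109, ?_⟩
  refine List.forall_mem_cons.2 ⟨slice_110, ?_⟩
  refine List.forall_mem_cons.2 ⟨slice_111, ?_⟩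
  refine List.forall_mem_cons.2 ⟨slice_112, ?_⟩
  refine List.forall_mem_cons.2 ⟨slice_113, ?_⟩
  refine List.forall_mem_cons.2 ⟨slice_114, ?_⟩
  refine List.forall_mem_cons.2 ⟨slice_115, ?_⟩
  refine List.forall_mem_cons.2 ⟨slice_116, ?_⟩
  refine List.forall_mem_cons.2 ⟨slice_117, ?_⟩
  refine List.forall_mem_cons.2 ⟨slice_118, ?_⟩
  refine List.forall_mem_cons.2 ⟨slice_119, ?_⟩
  refine List.forall_mem_cons.2 ⟨slice_120, ?_⟩
  refine List.forall_mem_cons.2 ⟨slice_121, ?_⟩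
  refine List.forall_mem_cons.2 ⟨slice_122, ?_⟩
  refine List.forall_mem_cons.2 ⟨slice_123, ?_⟩
  refine List.forall_mem_cons.2 ⟨slice_124, ?_⟩
  refine List.forall_mem_cons.2 ⟨slice_125, ?_⟩
  refine List.forall_mem_cons.2 ⟨slice_126, ?_⟩
  refine List.forall_mem_cons.2 ⟨slice_127, ?_⟩
  refine List.forall_mem_cons.2 ⟨slice_128, ?_⟩
  refine List.forall_mem_cons.2 ⟨slice_129, ?_⟩
  refine List.forall_mem_cons.2 ⟨slice_130, ?_⟩
  refine List.forall_mem_cons.2 ⟨slice_131, ?_⟩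
  refine List.forall_mem_cons.2 ⟨slice_132, ?_⟩
  refine List.forall_mem_cons.2 ⟨slice_133, ?_⟩
  refine List.forall_mem_cons.2 ⟨slice_134, ?_⟩
  refine List.forall_mem_cons.2 ⟨slice_135, ?_⟩
  refine List.forall_mem_cons.2 ⟨slice_136, ?_⟩
  refine List.forall_mem_cons.2 ⟨slice_137, ?_⟩
  refine List.forall_mem_cons.2 ⟨slice_138, ?_⟩
  refine List.forall_mem_cons.2 ⟨slice_139, ?_⟩
  refine List.forall_mem_cons.2 ⟨slice_140, ?_⟩
  refine List.forall_mem_cons.2 ⟨slice_141, ?_⟩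
  refine List.forall_mem_cons.2 ⟨slice_142, ?_⟩
  refine List.forall_mem_cons.2 ⟨slice_143, ?_⟩
  refine List.forall_mem_cons.2 ⟨slice_144, ?_⟩
  refine List.forall_mem_cons.2 ⟨slice_145, ?_⟩
  refine List.forall_mem_cons.2 ⟨slice_146, ?_⟩
  refine List.forall_mem_cons.2 ⟨slice_147, ?_⟩
  refine List.forall_mem_cons.2 ⟨slice_148, ?_⟩
  refine List.forall_mem_cons.2 ⟨slice_149, ?_⟩
  refine List.forall_mem_cons.2 ⟨slice_150, ?_⟩
  refine List.forall_mem_cons.2 ⟨slice_151, ?_⟩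
  refine List.forall_mem_cons.2 ⟨slice_152, ?_⟩
  refine List.forall_mem_cons.2 ⟨slice_153, ?_⟩
  refine List.forall_mem_cons.2 ⟨slice_154, ?_⟩
  refine List.forall_mem_cons.2 ⟨slice_155, ?_⟩
  refine List.forall_mem_cons.2 ⟨slice_156, ?_⟩
  refine List.forall_mem_cons.2 ⟨slice_157, ?_⟩
  refine List.forall_mem_cons.2 ⟨slice_158, ?_⟩
  refine List.forall_mem_cons.2 ⟨slice_159, ?_⟩
  refine List.forall_mem_cons.2 ⟨slice_160, ?_⟩
  refine List.forall_mem_cons.2 ⟨slice_161, ?_⟩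
  refine List.forall_mem_cons.2 ⟨slice_162, ?_⟩
  refine List.forall_mem_cons.2 ⟨slice_163, ?_⟩
  refine List.forall_mem_cons.2 ⟨slice_164, ?_⟩
  refine List.forall_mem_cons.2 ⟨slice_165, ?_⟩
  refine List.forall_mem_cons.2 ⟨slice_166, ?_⟩
  refine List.forall_mem_cons.2 ⟨slice_167, ?_⟩
  refine List.forall_mem_cons.2 ⟨slice_168, ?_⟩
  refine List.forall_mem_cons.2 ⟨slice_169, ?_⟩
  refine List.forall_mem_cons.2 ⟨slice_170, ?_⟩
  refine List.forall_mem_cons.2 ⟨slice_171, ?_⟩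
  refine List.forall_mem_cons.2 ⟨slice_172, ?_⟩
  refine List.forall_mem_cons.2 ⟨slice_173, ?_⟩
  refine List.forall_mem_cons.2 ⟨slice_174, ?_⟩
  refine List.forall_mem_cons.2 ⟨slice_175, ?_⟩
  refine List.forall_mem_cons.2 ⟨slice_176, ?_⟩
  refine List.forall_mem_cons.2 ⟨slice_177, ?_⟩
  refine List.forall_mem_cons.2 ⟨slice_178, ?_⟩
  refine List.forall_mem_cons.2 ⟨slice_179, ?_⟩
  refine List.forall_mem_cons.2 ⟨slice_180, ?_⟩
  refine List.forall_mem_cons.2 ⟨slice_181, ?_⟩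
  refine List.forall_mem_cons.2 ⟨slice_182, ?_⟩
  refine List.forall_mem_cons.2 ⟨slice_183, ?_⟩
  refine List.forall_mem_cons.2 ⟨slice_184, ?_⟩
  refine List.forall_mem_cons.2 ⟨slice_185, ?_⟩
  refine List.forall_mem_cons.2 ⟨slice_186, ?_⟩
  refine List.forall_mem_cons.2 ⟨slice_187, ?_⟩
  refine List.forall_mem_cons.2 ⟨slice_188, ?_⟩
  refine List.forall_mem_cons.2 ⟨slice_189, ?_⟩
  refine List.forall_mem_cons.2 ⟨slice_190, ?_⟩
  refine List.forall_mem_cons.2 ⟨slice_191, ?_⟩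
  refine List.forall_mem_cons.2 ⟨slice_192, ?_⟩
  refine List.forall_mem_cons.2 ⟨slice_193, ?_⟩
  refine List.forall_mem_cons.2 ⟨slice_194, ?_⟩
  refine List.forall_mem_cons.2 ⟨slice_195, ?_⟩
  refine List.forall_mem_cons.2 ⟨slice_196, ?_⟩
  refine List.forall_mem_cons.2 ⟨slice_197, ?_⟩
  refine List.forall_mem_cons.2 ⟨slice_198, ?_⟩
  refine List.forall_mem_cons.2 ⟨slice_199, ?_⟩
  refine List.forall_mem_cons.2 ⟨slice_200, ?_⟩
  refine List.forall_mem_cons.2 ⟨slice_201, ?_⟩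
  refine List.forall_mem_cons.2 ⟨slice_202, ?_⟩
  refine List.forall_mem_cons.2 ⟨slice_203, ?_⟩
  refine List.forall_mem_cons.2 ⟨slice_204, ?_⟩
  refine List.forall_mem_cons.2 ⟨slice_205, ?_⟩
  refine List.forall_mem_cons.2 ⟨slice_206, ?_⟩
  refine List.forall_mem_cons.2 ⟨slice_207, ?_⟩
  refine List.forall_mem_cons.2 ⟨slice_208, ?_⟩
  refine List.forall_mem_cons.2 ⟨slice_209, ?_⟩
  refine List.forall_mem_cons.2 ⟨slice_210, ?_⟩
  refine List.forall_mem_cons.2 ⟨slice_211, ?_⟩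
  refine List.forall_mem_cons.2 ⟨slice_212, ?_⟩
  refine List.forall_mem_cons.2 ⟨slice_213, ?_⟩
  refine List.forall_mem_cons.2 ⟨slice_214, ?_⟩
  refine List.forall_mem_cons.2 ⟨slice_215, ?_⟩
  refine List.forall_mem_cons.2 ⟨slice_216, ?_⟩
  refine List.forall_mem_cons.2 ⟨slice_217, ?_⟩
  refine List.forall_mem_cons.2 ⟨slice_218, ?_⟩
  refine List.forall_mem_cons.2 ⟨slice_219, ?_⟩
  refine List.forall_mem_cons.2 ⟨slice_220, ?_⟩
  refine List.forall_mem_cons.2 ⟨slice_221, ?_⟩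
  refine List.forall_mem_cons.2 ⟨slice_222, ?_⟩
  refine List.forall_mem_cons.2 ⟨slice_223, ?_⟩
  refine List.forall_mem_cons.2 ⟨slice_224, ?_⟩
  refine List.forall_mem_cons.2 ⟨slice_225, ?_⟩
  intro w hw
  simp at hw

/-- **THE `[3]³` PATTERN INEQUALITY, KERNEL-ONLY**: `sStarD A B C ≥ 0` for all up-sets `A, B, C` of the small cube (this is
`PatternPos 3` — as a term: `fun A B C => sStarD_three_nonneg A B C` — now with standard axioms; the computational
`patternPos_three` of `…SahiGridPatternThree` is superseded). [this work] -/
theorem sStarD_three_nonneg (A B C : Finset P3) (hA : IsUpperSet (A : Set P3)) (hB : IsUpperSet (B : Set P3))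
    (hC : IsUpperSet (C : Set P3)) : 0 ≤ sStarD A B C :=
  patternPos_three_of_slices slices_all A B C hA hB hC

/-- **Sahi's third-order inequality for every FKG weight on every three-dimensional grid, KERNEL-ONLY** (cell `(3,3)` of the width
stratification = `W(3,3)`, explicit form): for every log-supermodular probability weight `μ` on `[b+1]³` and all nonnegative monotone
`f₀, f₁, f₂`, `E₃(f₀,f₁,f₂) ≥ 0`.  (`SahiPositive μ 3` as a term: `fun f hf hm => sahiE_three_nonneg_fkg_grid3 hμ f hf hm`.) [this work] -/
theorem sahiE_three_nonneg_fkg_grid3 {b : ℕ} {μ : (Fin 3 → Fin (b + 1)) → ℝ} (hμ : IsFKGMeasure μ)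
    (f : Fin 3 → (Fin 3 → Fin (b + 1)) → ℝ) (hf : ∀ i x, 0 ≤ f i x) (hm : ∀ i, Monotone (f i)) : 0 ≤ sahiE μ 3 f :=
  fkg_grid_of_patternPos (fun A B C => sStarD_three_nonneg A B C) b μ hμ f hf hm

/-- **Coefficientwise `C₃` on every three-dimensional grid, KERNEL-ONLY**: for up-sets `A, B, C` of `[K+1]³` the symmetrised
three-copy kernel `Ssym A B C ω` is nonnegative at EVERY configuration `ω` of the three copies — i.e. the homogeneous Sahi cubic
`Z³E₃(A,B,C)` is a polynomial with nonnegative coefficients in the chain weights (by `latticeE3_symm`; the value form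
`0 ≤ latticeE3 w A B C` is `latticeE3_gridProd_nonneg_of (fun A B C => sStarD_three_nonneg A B C)`). [this work] -/
theorem Ssym_three_nonneg {K : ℕ} {A B C : Finset (Xd 3 K)} (hA : IsUpperSet (A : Set (Xd 3 K)))
    (hB : IsUpperSet (B : Set (Xd 3 K))) (hC : IsUpperSet (C : Set (Xd 3 K))) (ω : Fin 3 → Xd 3 K) : 0 ≤ Ssym A B C ω :=
  Ssym_nonneg_of (fun A B C => sStarD_three_nonneg A B C) hA hB hC ω

/-- **Lieb–Sahi's Conjecture 1.1 on the unit cube `[0,1]³` at order 3, KERNEL-ONLY**, increasing form: for Lebesgue measure and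
all nonnegative monotone (increasing) `f₀, f₁, f₂ : [0,1]³ → ℝ`, `E₃ = 2∫f₀f₁f₂ + ∫f₀∫f₁∫f₂ − Σ ∫fᵢ∫fⱼfₖ ≥ 0` (measure-level `msahiE`;
the decreasing form `LiebSahiContinuum 3 3` follows by `liebSahiContinuum_iff_mSahiPositive`). [this work] -/
theorem msahiE_three_volume_cube_nonneg (f : Fin 3 → (Fin 3 → unitInterval) → ℝ) (hf : ∀ i x, 0 ≤ f i x)
    (hm : ∀ i, Monotone (f i)) : 0 ≤ msahiE (MeasureTheory.volume : MeasureTheory.Measure (Fin 3 → unitInterval)) 3 f :=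
  (liebSahiContinuum_iff_mSahiPositive.1 (liebSahiContinuum_of_patternPos fun A B C => sStarD_three_nonneg A B C)) f hf hm

end Summit.CriticalPhenomena.PercolationContinuityZ3.Theorems.SahiGridPattern
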